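import Summits.Parity.GeneralizedHardyLittlewood.Theorems.Dhl42Certificate
import Summits.Parity.GeneralizedHardyLittlewood.Theorems.Dhl42MainJ
import Summits.Parity.GeneralizedHardyLittlewood.Theorems.Dhl42KernelBridge

/-!
# DHL[42,2] certificate — the closed forms `I(F₀) = iSum`, `42·J^K(F₀) = jkSum` and the inputs C1, C2 as theorems

Assembly of the closed-form layer: `Ival_eq_iSum` (`Ival_eq_pairedI` of `Dhl42MainIPairs` with the
kernel bridge `pairedI_eq_iSum`) and `JKval42_eq_jkSum` (`JKval42_eq_pairedJ` of `Dhl42MainJ` with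
`pairedJ_eq_jkSum`); hence the inequalities `IClosedForm`, `JKClosedForm` of `Dhl42Certificate` are
theorems, the certificate inputs C1 (`16594281924.53 ≤ 42·J^K(F₀)`) and C2 (`I(F₀) ≤ 4308892660.35`)
hold unconditionally, `I(F₀) > 0`, and eq. (32) holds for the paper's functionals given only the
loss bounds C3, C4 (`sieveRatio_ge_exact`). Axiom closure of `Ival_eq_iSum` / `JKval42_eq_jkSum`:
`propext`, `Classical.choice`, `Quot.sound` (the kernel evaluations are ordinary theorems). The
package's axiom-consuming corollaries (`certificateInputsExact`, `DHL_42_exact`, …, its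
`#print axioms` audit) are not migrated; the hypothesis-explicit headline over tree vocabulary is
batch B5.

Origin: `Dhl42/ClosedForm.lean` of the DHL[42,2] certificate package (pub-dhl42 bundle, archive blob
`18cce9e3`; sha256[:16] of the file `bb3125955e50330f`; paper snapshot = `paper/main.tex` v1), lines
:59–:92; statements and proofs unchanged except: namespace `TpY4Dhl42` (with
`open Dhl42 Dhl42.ClosedForm`) → `Summit.Parity.GeneralizedHardyLittlewood.Theorems.Dhl42` with
`open Summit.Parity.GeneralizedHardyLittlewood.Theorems.Dhl42.ClosedForm`, docstrings added where
missing (the docstrings of `Ival_eq_iSum`, `JKval42_eq_jkSum`, `I_closedForm_thm`,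
`JK_closedForm_thm`, `JK_certified_exact`, `I_certified_exact` re-worded for the tree:
package-internal pointers removed, mathematics unchanged).

Declarations (8): `Ival_eq_iSum`, `JKval42_eq_jkSum`, `I_closedForm_thm`, `JK_closedForm_thm`,
`JK_certified_exact`, `I_certified_exact`, `Ival_pos`, `sieveRatio_ge_exact`.
-/

open Summit.Parity.GeneralizedHardyLittlewood.Theorems.Dhl42.ClosedForm

namespace Summit.Parity.GeneralizedHardyLittlewood.Theorems.Dhl42

/-! ## The two closed forms as equalities; the certificate inputs C1, C2 as theorems -/

/-- **`I(F₀) = iSum`** (paper Lemma 6.1(b), §6.3): the exact value of `I(F₀)` is the 23-term element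
`iSum ∈ ℚ[e^ℚ]` of `Dhl42MainTermsData` (`Ival_eq_pairedI`, then the kernel bridge
`pairedI_eq_iSum`). -/
theorem Ival_eq_iSum : Ival = iSum := Ival_eq_pairedI.trans pairedI_eq_iSum

/-- **`42·J^K(F₀) = jkSum`** (paper Lemma 6.1(c), §6.3): the exact value of `42·J^K(F₀)` is the
113-term element `jkSum ∈ ℚ[e^ℚ]` of `Dhl42MainTermsData` (`JKval42_eq_pairedJ`, then the kernel
bridge `pairedJ_eq_jkSum`). -/
theorem JKval42_eq_jkSum : 42 * JKval = jkSum := JKval42_eq_pairedJ.trans pairedJ_eq_jkSum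

/-- The inequality `IClosedForm : I(F₀) ≤ iSum` consumed by the certificate arithmetic, as a
theorem. -/
theorem I_closedForm_thm : IClosedForm := le_of_eq Ival_eq_iSum

/-- The inequality `JKClosedForm : jkSum ≤ 42·J^K(F₀)` consumed by the certificate arithmetic, as a
theorem. -/
theorem JK_closedForm_thm : JKClosedForm := le_of_eq JKval42_eq_jkSum.symm

/-- Input C1 as a theorem: `16594281924.53 ≤ 42·J^K(F₀)` (closed form and the kernel enclosure
`jkSum_lb`). -/
theorem JK_certified_exact : (16594281924.53 : ℝ) ≤ 42 * JKval :=
  JK_certified_of_closedForm JK_closedForm_thm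

/-- Input C2 as a theorem: `I(F₀) ≤ 4308892660.35` (closed form and the kernel enclosure `iSum_ub`).
-/
theorem I_certified_exact : Ival ≤ 4308892660.35 :=
  I_certified_of_closedForm I_closedForm_thm

/-- `I(F₀) > 0` (in fact `I(F₀) = iSum ≥ 4308892660.34`). -/
theorem Ival_pos : 0 < Ival := by rw [Ival_eq_iSum]; exact iSum_pos

/-- The certificate ratio of eq. (32) for the paper's functionals themselves, now unconditional in the
main terms: for any bin families obeying C4 and given C3,
`(42·J^K(F₀) − 42·L_G − 2·Σ√(AB)) / I(F₀) ≥ 3.84176 (> 2/θ)`. -/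
theorem sieveRatio_ge_exact (hLG : 42 * LGval ≤ 24124586.5)
    (bf : ∀ m : Member, MemberBins (memberTau0 m)) (hX : 2 * totalCross bf ≤ 16418728.9) :
    (3.84176 : ℝ) ≤ (42 * JKval - 42 * LGval - 2 * totalCross bf) / Ival :=
  sieveRatio_ge JK_closedForm_thm I_closedForm_thm Ival_pos hLG bf hX

end Summit.Parity.GeneralizedHardyLittlewood.Theorems.Dhl42
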